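import Literature.NumberTheory.EllipticCurves.TianYuanZhang2017.UPlusOfGenusPointData
import Summits.BirchSwinnertonDyer.Rank1Residual.P2.CongruentNumberLevelTwoDoor
import HarnessLib

/-!
# Route `PrintCf2`, crux stmt-BirchSwinnertonDyer-20509 `RamifiedOffTYZOfFacts` — THE LEVEL-TWO READING OF
# TIAN–YUAN–ZHANG'S THEOREM 3.5 ON THE JUMP-ONE CLASS: the research stub C⁺ = `stub_offTYZ_levelTwoScriptLExact`
# («`2 ∥ 𝓛(n)`») typed in the genus-point currency `TianYuanZhang2017.GenusPointData` — C⁺ at `n` is EQUIVALENT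
# (granted Thm 3.5's main clause as printed and GZK) to «`2^{ρ(n)}·P(n) ≡ m·α_n (mod A(ℍ′_n)_tor)` with `m` ODD»
# (cell `bsd-print-cf2`, LEAD of 20509, line `offtyz-v7`, cycle-1 deliverable (a); fact-free, Theses-free)

HONEST FRAMING (cell `bsd-print-cf2`, run/shared/lean/pub/bsd-print-cf2/; route `PrintCf2`; crux 20509 =
`𝔅_ram → WAllCornerFTwoRamifiedOffTYZProved`, DECIDING, OPEN AS A CLASS): bookkeeping on a PRINTED statement — no
named fact is introduced, nothing is asserted, no `def`. The registered research stub of line `offtyz-v7` is C⁺ =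
`stub_offTYZ_levelTwoScriptLExact`: for square-free `n ≡ 5, 6, 7 (mod 8)` with `ord_{s=1} L(E_n, s) = 1`,
`#Sel₂(E_n) = 2⁵`, `#Sel₄(E_n) = 2⁶`, every integer `L` with `𝓛(n)² = L²` satisfies `2 ∣ L ∧ 4 ∤ L` (OPEN, NO
PRINT; equivalent to `BSD(E_n, 2)` on that class by the landed door `P2.bsdp_two_congruentNumberCurve_iff_two_dvd_not_four_dvd`).
Tian–Yuan–Zhang prove their parity theorem (Thm 1.2 = Thm 3.5 (2)) from the MAIN CLAUSE of Thm 3.5: "the vector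
`𝒫(n) := 2^{−1−ρ(n)}𝓛(n)α_n ∈ A(K_n)⁻ ⊗ ℚ` is represented by the point `P(n) ∈ A(ℍ′_n)`", i.e. (tree display
`GenusPointData.thm35Main`, typed by the P2 programme, p2-lit-1) `2^{ρ+1}·P(n) − s·𝓛(n)·α` is torsion in `A(ℍ′_n)`
for a sign `s` and every generator `α` of the free part of `A(K_n)⁻`, where `2^{ρ(n)} = [E_n(ℚ) : φ_n(A_n(ℚ)) + E_n[2]]`
(`rhoSubgroup`). The printed "i.e." of Thm 3.5's second bullet reads this clause MODULO 2:
«`P(n) ∈ A(K_n)⁻ + A[4]` ⟺ `2^{ρ+1} ∣ 𝓛(n)`». THIS FILE reads the same clause ONE 2-ADIC DIGIT HIGHER, which is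
exactly what C⁺ asks:

* §1 `levelTwo_iff_of_torsionRelation` (pure group theory, "LAYER A" style of `GenusDescentAbstract`): in any additive
  commutative group, if `α` is non-torsion, `s = ±1`, `L ≠ 0` and `2^{ρ+1}·P − s·L·α` is torsion, then
  **`(2 ∣ L ∧ 4 ∤ L) ⟺ ∃ m odd, 2^ρ·P − m·α is torsion`**.
* §2 `levelTwoScriptLExact_iff_genusPoint` (the reading on `E_n`): for square-free `n ≡ 5, 6, 7 (mod 8)` with
  `ord_{s=1} L(E_n, s) = 1`, granted GZK (`hGZK`: rank `E_n(ℚ) = 1`, so `A(K_n)⁻ ≅ A_n′(ℚ)` has a non-torsion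
  generator — the tree's twist transfer `W2.stub_twist` + `W2.stub_S0'`) and data `D : GenusPointData n` satisfying
  the displayed main clause `D.thm35Main` and `D.scriptLSpec`, with `2^ρ = [E_n(ℚ) : φ_n(A_n(ℚ)) + E_n[2]]`:
  **`(2 ∣ 𝓛(n) ∧ 4 ∤ 𝓛(n)) ⟺ ∃ α generating the free part of A(K_n)⁻, ∃ m odd, 2^ρ·P(n) − m·α ∈ A(ℍ′_n)_tor`**
  (and the `∀ α` form). The level-ONE reading (print) is `2 ∣ 2^{−ρ}𝓛(n) ⟺ P(n) ∈ A(K_n)⁻ + A[4]`; the level-TWO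
  reading is about `2^ρ·P(n)` landing on an ODD multiple of the generator modulo torsion.
* §3 the transfer to the registered stub: `genusPoint_of_levelTwoScriptLExact` (C⁺ ⟹ the point statement for every
  such `D` on the class) and `levelTwoScriptLExact_of_genusPoint` (the point statement for SOME `D` with `thm35Main ∧
  scriptLSpec` on every member of the class ⟹ C⁺ VERBATIM, sign of `𝓛(n)` handled by `L² = 𝓛(n)²`); hence, granted the
  ONE named fact `TianYuanZhang2017.tyz_genusPointData` (TYZ §3 as printed; NOT a conjunct of 𝔅_ram — the same status as
  the U⁺ door, aside 20471) and GZK, **C⁺ ⟺ «on the jump-one rank-one class, `2^{ρ(n)}·P(n)` is an odd multiple of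
  `α_n` modulo `A(ℍ′_n)_tor`»** (`levelTwoScriptLExact_iff_genusPoint_of_tyz`).

What this buys the line (LEAD note): TYZ's Prop 3.4 (`GenusPointData.prop34`) expands `P(n)` modulo `2A(ℍ′_n)` in genus
points `Z(d₀)` weighted by genus class numbers `g(dᵢ)`; on the s = 3 class every such weight is even (the genus sums
are even there — Thm 1.2 is silent), so `P(n) ∈ 2A(ℍ′_n) + (explicit)`; C⁺ is then the statement that the HALF
`P(n)/2` (resp. `2^ρ P(n)`) sits on an odd multiple of `α_n` — the «induction read modulo 4» the card names, now with a
kernel target in the tree's own §3 vocabulary. Nothing here is beyond print except C⁺ itself; beyond-print theorem: NO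
(bookkeeping of Thm 3.5's main clause). BSD is not proved by any of this; no class is closed by this file.

References: [cite: TianYuanZhang2017, Thm. 3.5 (arXiv:1411.4728 chunk p0011 L94–L112) and §3.1 (p0011 L27–L36); Thm. 1.2
(p0002 L112–L127); Prop. 3.4 (p0011 L76–L89)]; [cite: Darmon2004, Thm. 3.22] (GZK, the binder `hGZK`);
[cite: Miller2011LMS, Def. 1.1]; tree: `TianYuanZhang2017/GenusPointDescentDisplays.lean` (the displays),
`TianYuanZhang2017/UPlusOfGenusPointData.lean` (U⁺ from the same clause), `Rank1Residual/P2/CongruentNumberLevelTwoDoor.lean`.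
-/

noncomputable section

open scoped Classical

open WeierstrassCurve WeierstrassCurve.Affine Literature.NumberTheory.EllipticCurves
  Literature.NumberTheory.EllipticCurves.Rank1Residual Summit.BirchSwinnertonDyer.Rank1Residual
  Literature.NumberTheory.EllipticCurves.TianYuanZhang2017
  Literature.NumberTheory.EllipticCurves.TianYuanZhang2017.W2

set_option autoImplicit false

namespace Summit.BirchSwinnertonDyer.PrintCf2.LevelTwo

/-! ## §1 Layer A: the level-two reading of a torsion relation `2^{ρ+1}·P − s·L·α ∈ tors` -/

section Abstract

variable {G : Type*} [AddCommGroup G]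

/-- `k • y` of finite order with `k ≠ 0` forces `y` of finite order. [folklore] -/
theorem isOfFinAddOrder_of_zsmul {y : G} {k : ℤ} (hk : k ≠ 0) (h : IsOfFinAddOrder (k • y)) :
    IsOfFinAddOrder y := by
  have hk' : k.natAbs ≠ 0 := Int.natAbs_ne_zero.mpr hk
  refine W2.Abstract.isOfFinAddOrder_of_nsmul hk' ?_
  rcases Int.natAbs_eq k with hke | hke
  · have e : k.natAbs • y = k • y := by
      conv_rhs => rw [hke]
      exact (natCast_zsmul y k.natAbs).symm
    rwa [e]
  · have e : k.natAbs • y = -(k • y) := by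
      conv_rhs => rw [hke]
      rw [neg_smul, neg_neg]
      exact (natCast_zsmul y k.natAbs).symm
    rw [e]
    exact h.neg

/-- A non-torsion element has no non-zero torsion multiple. [folklore] -/
theorem eq_zero_of_isOfFinAddOrder_zsmul {α : G} (hα : ¬ IsOfFinAddOrder α) {k : ℤ}
    (h : IsOfFinAddOrder (k • α)) : k = 0 := by
  by_contra hk
  exact hα (isOfFinAddOrder_of_zsmul hk h)

/-- **THE LEVEL-TWO READING (abstract).** In an additive commutative group let `α` be non-torsion, `s = ±1`, and
suppose `2^{ρ+1}·P − (s·L)·α` has finite order (Tian–Yuan–Zhang, Thm 3.5 main clause: `P = P(n)`, `α = α_n`,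
`L = 𝓛(n)`). Then `2 ∣ L ∧ 4 ∤ L` iff `2^ρ·P − m·α` has finite order for some ODD integer `m`. (The level-one
reading of the same relation is the printed "i.e." of Thm 3.5's second bullet.) [cite: TianYuanZhang2017, Thm. 3.5 (chunk p0011 L94–L100)] -/
theorem levelTwo_iff_of_torsionRelation {P α : G} (hα : ¬ IsOfFinAddOrder α) {ρ : ℕ} {L s : ℤ}
    (hs : s = 1 ∨ s = -1) (hrel : IsOfFinAddOrder (((2 : ℤ) ^ (ρ + 1)) • P - (s * L) • α)) :
    ((2 : ℤ) ∣ L ∧ ¬ (4 : ℤ) ∣ L) ↔ ∃ m : ℤ, Odd m ∧ IsOfFinAddOrder (((2 : ℤ) ^ ρ) • P - m • α) := by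
  constructor
  · rintro ⟨⟨L', rfl⟩, h4⟩
    have hL' : Odd L' := by
      rcases Int.even_or_odd L' with ⟨j, hj⟩ | hodd
      · exact absurd ⟨j, by rw [hj]; ring⟩ h4
      · exact hodd
    refine ⟨s * L', ?_, ?_⟩
    · rcases hs with rfl | rfl
      · simpa using hL'
      · simpa using hL'.neg
    · have e : ((2 : ℤ) ^ (ρ + 1)) • P - (s * (2 * L')) • α = (2 : ℤ) • ((((2 : ℤ) ^ ρ) • P - (s * L') • α)) := by
        module
      rw [e, show ((2 : ℤ) • ((((2 : ℤ) ^ ρ) • P - (s * L') • α))) =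
        (2 : ℕ) • ((((2 : ℤ) ^ ρ) • P - (s * L') • α)) from by norm_cast] at hrel
      exact W2.Abstract.isOfFinAddOrder_of_two_nsmul hrel
  · rintro ⟨m, hm, hX⟩
    -- `2^{ρ+1}P − 2m α` is torsion, hence so is `(2m − sL) α`, hence `sL = 2m`
    have h2 : IsOfFinAddOrder (((2 : ℤ) ^ (ρ + 1)) • P - (2 * m) • α) := by
      have e : ((2 : ℤ) ^ (ρ + 1)) • P - (2 * m) • α = (2 : ℤ) • ((((2 : ℤ) ^ ρ) • P - m • α)) := by
        module
      rw [e]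
      exact hX.zsmul
    have h3 : IsOfFinAddOrder ((2 * m - s * L) • α) := by
      have e : (2 * m - s * L) • α =
          (((2 : ℤ) ^ (ρ + 1)) • P - (s * L) • α) + -((((2 : ℤ) ^ (ρ + 1)) • P - (2 * m) • α)) := by
        module
      rw [e]
      exact hrel.add h2.neg
    have h4 : 2 * m - s * L = 0 := eq_zero_of_isOfFinAddOrder_zsmul hα h3
    have hL : L = s * (2 * m) := by
      rcases hs with rfl | rfl <;> linarith
    obtain ⟨j, rfl⟩ := hm
    refine ⟨⟨s * (2 * j + 1), by rw [hL]; ring⟩, ?_⟩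
    rintro ⟨q, hq⟩
    rcases hs with rfl | rfl <;> omega

end Abstract

/-! ## §2 The reading on `E_n`: C⁺ at `n` ⟺ `2^ρ·P(n)` is an odd multiple of `α_n` modulo torsion -/

section EnSide

variable {n : ℕ}

/-- `Point.map` along an algebra map reflects finite order (it is an injective homomorphism). [folklore] -/
theorem isOfFinAddOrder_of_map {F K : Type} [Field F] [Field K] [Algebra ℚ F] [Algebra ℚ K]
    (f : F →ₐ[ℚ] K) {x : (curveA.baseChange F).toAffine.Point}
    (h : IsOfFinAddOrder (Point.map (W' := curveA) f x)) : IsOfFinAddOrder x := by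
  obtain ⟨N, hN, hNx⟩ := h.exists_nsmul_eq_zero
  refine isOfFinAddOrder_iff_nsmul_eq_zero.mpr ⟨N, hN, ?_⟩
  apply Point.map_injective (W' := curveA) (f := f)
  rw [map_nsmul, hNx, map_zero]

/-- Rank `≥ 1` gives a point of infinite order (junction form with an explicit `DecidableEq` binder, see the
design note at `W2.exists_generator_mod_torsion`). [folklore] -/
theorem exists_not_isOfFinAddOrder_of_one_le_rank {K : Type*} [Field K] [dK : DecidableEq K]
    (W : WeierstrassCurve K) (hr : 1 ≤ W.mordellWeilRank) :
    ∃ x : W.toAffine.Point, ¬ IsOfFinAddOrder x := by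
  have e : dK = Classical.decEq K := Subsingleton.elim _ _
  subst e
  exact exists_not_isOfFinAddOrder_of_one_le_finrank hr

/-- A generator modulo torsion of a group containing a non-torsion element is non-torsion. [folklore] -/
theorem not_isOfFinAddOrder_of_generates {G : Type*} [AddCommGroup G] {α x : G} (hx : ¬ IsOfFinAddOrder x)
    (hα : ∃ k : ℤ, IsOfFinAddOrder (x - k • α)) : ¬ IsOfFinAddOrder α := by
  intro hfin
  obtain ⟨k, hk⟩ := hα
  apply hx
  have e : x = (x - k • α) + k • α := by abel
  rw [e]
  exact hk.add hfin.zsmul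

/-- **On the rank-one class, `A(K_n)⁻` has a NON-TORSION generator of its free part** (granted GZK): for
square-free `n ≡ 5, 6, 7 (mod 8)` with `ord_{s=1} L(E_n, s) = 1`, some `α ∈ A(K_n)⁻` generates `A(K_n)⁻` modulo
torsion and has infinite order — the twist transfer `Θ_A : A_n′(ℚ) ↠ A(K_n)⁻` (`W2.stub_twist`, torsion-faithful)
applied to a generator of `A_n′(ℚ)` modulo torsion (`W2.stub_S0'`), non-torsion because `rank A_n′(ℚ) = rank E_n(ℚ)
= 1` (isogeny invariance + GZK). [cite: TianYuanZhang2017, §3.1 (chunk p0011 L27–L36)] [cite: Darmon2004, Thm. 3.22] -/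
theorem exists_generatesFreePart_not_isOfFinAddOrder (hGZK : rank_eq_analyticRank_of_analyticRank_le_one)
    (hsq : Squarefree n) (hr : (congruentNumberCurve n).analyticRank = 1) :
    ∃ α : APoint (GenusField n), GeneratesFreePart n α ∧ ¬ IsOfFinAddOrder α := by
  haveI := isElliptic_congruentNumberCurve hsq.ne_zero
  have hn : n ∈ n.divisors := Nat.mem_divisors_self n hsq.ne_zero
  have hrank : (congruentNumberCurve n).mordellWeilRank = 1 := (hGZK _ hr.le).1.trans hr
  obtain ⟨ΘA, -, hmem, hsurj, hfaith, -, -, -⟩ := stub_twist hsq hn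
  obtain ⟨α₀, hα₀⟩ := stub_S0' (n := n) hrank.le
  have hrank2 : 1 ≤ (Atwo n).mordellWeilRank := by
    rw [← (congruentNumberCurve n).twoIsogeny.mordellWeilRank_eq, hrank]
  obtain ⟨x, hx⟩ := exists_not_isOfFinAddOrder_of_one_le_rank (Atwo n) hrank2
  have hα₀nt : ¬ IsOfFinAddOrder α₀ := not_isOfFinAddOrder_of_generates hx (hα₀ x)
  exact ⟨ΘA α₀, generatesFreePart_of_twist ΘA hmem hsurj hα₀, fun h => hα₀nt (hfaith α₀ h)⟩

/-- Every generator of the free part of `A(K_n)⁻` is non-torsion as soon as one is. [cite: TianYuanZhang2017, §3.1 (chunk p0011 L33–L36)] -/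
theorem not_isOfFinAddOrder_of_generatesFreePart {α β : APoint (GenusField n)} (hα : GeneratesFreePart n α)
    (hαnt : ¬ IsOfFinAddOrder α) (hβ : GeneratesFreePart n β) : ¬ IsOfFinAddOrder β :=
  not_isOfFinAddOrder_of_generates hαnt (hβ.2 α hα.1)

/-- **THE LEVEL-TWO READING OF THM 3.5 ON `E_n` (the `∀ α` form).** Square-free `n ≡ 5, 6, 7 (mod 8)` with
`ord_{s=1} L(E_n, s) = 1`; GZK; data `D : GenusPointData n` with the displayed main clause of Thm 3.5 (`h35`) and the
displayed integrality (`hLs`, `𝓛(d)² = (D.scriptL d)²`); `2^ρ = [E_n(ℚ) : φ_n(A_n(ℚ)) + E_n[2]]`. Then for EVERY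
generator `α` of the free part of `A(K_n)⁻`:
**`(2 ∣ 𝓛(n) ∧ 4 ∤ 𝓛(n)) ⟺ ∃ m odd, 2^ρ·P(n) − m·α ∈ A(ℍ′_n)_tor`.**
[cite: TianYuanZhang2017, Thm. 3.5 (chunk p0011 L94–L100) and §3.1 (p0011 L27–L36)] [cite: Darmon2004, Thm. 3.22] -/
theorem levelTwoScriptLExact_iff_genusPoint_of_generatesFreePart
    (hGZK : rank_eq_analyticRank_of_analyticRank_le_one) (hsq : Squarefree n)
    (h8 : n % 8 = 5 ∨ n % 8 = 6 ∨ n % 8 = 7) (hr : (congruentNumberCurve n).analyticRank = 1)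
    (D : GenusPointData n) (h35 : D.thm35Main) (hLs : D.scriptLSpec) {ρ : ℕ} (hρ : (rhoSubgroup n).index = 2 ^ ρ)
    {α : APoint (GenusField n)} (hα : GeneratesFreePart n α) :
    ((2 : ℤ) ∣ D.scriptL n ∧ ¬ (4 : ℤ) ∣ D.scriptL n) ↔
      ∃ m : ℤ, Odd m ∧ IsOfFinAddOrder (((2 : ℤ) ^ ρ) • D.P n -
        m • Point.map (W' := curveA) (D.embK n (Nat.mem_divisors_self n hsq.ne_zero)) α) := by
  haveI := isElliptic_congruentNumberCurve hsq.ne_zero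
  have hn : n ∈ n.divisors := Nat.mem_divisors_self n hsq.ne_zero
  have hn1 : 1 < n := by rcases h8 with h | h | h <;> omega
  have hL : IsScriptL n (D.scriptL n) := hLs n hn hn1
  have hL0 : D.scriptL n ≠ 0 := (P2.bsdp_two_congruentNumberCurve_iff_of_isScriptL hGZK hsq hr hL).2.2.1
  obtain ⟨α₁, hα₁, hα₁nt⟩ := exists_generatesFreePart_not_isOfFinAddOrder hGZK hsq hr
  have hαnt : ¬ IsOfFinAddOrder α := not_isOfFinAddOrder_of_generatesFreePart hα₁ hα₁nt hα
  have hαnt' : ¬ IsOfFinAddOrder (Point.map (W' := curveA) (D.embK n hn) α) :=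
    fun h => hαnt (isOfFinAddOrder_of_map (D.embK n hn) h)
  obtain ⟨s, hs, hrel⟩ := ((h35 hn ρ hρ).2 hL0) α hα
  exact levelTwo_iff_of_torsionRelation hαnt' hs hrel

/-- **The `∃ α` form.** Same hypotheses: `(2 ∣ 𝓛(n) ∧ 4 ∤ 𝓛(n)) ⟺ ∃ α` generating the free part of `A(K_n)⁻`,
`∃ m` odd, `2^ρ·P(n) − m·α ∈ A(ℍ′_n)_tor`. [cite: TianYuanZhang2017, Thm. 3.5 (chunk p0011 L94–L100) and §3.1 (p0011 L27–L36)] -/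
theorem levelTwoScriptLExact_iff_genusPoint
    (hGZK : rank_eq_analyticRank_of_analyticRank_le_one) (hsq : Squarefree n)
    (h8 : n % 8 = 5 ∨ n % 8 = 6 ∨ n % 8 = 7) (hr : (congruentNumberCurve n).analyticRank = 1)
    (D : GenusPointData n) (h35 : D.thm35Main) (hLs : D.scriptLSpec) {ρ : ℕ} (hρ : (rhoSubgroup n).index = 2 ^ ρ) :
    ((2 : ℤ) ∣ D.scriptL n ∧ ¬ (4 : ℤ) ∣ D.scriptL n) ↔
      ∃ α : APoint (GenusField n), GeneratesFreePart n α ∧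
        ∃ m : ℤ, Odd m ∧ IsOfFinAddOrder (((2 : ℤ) ^ ρ) • D.P n -
          m • Point.map (W' := curveA) (D.embK n (Nat.mem_divisors_self n hsq.ne_zero)) α) := by
  obtain ⟨α₁, hα₁, -⟩ := exists_generatesFreePart_not_isOfFinAddOrder hGZK hsq hr
  constructor
  · intro h
    exact ⟨α₁, hα₁,
      (levelTwoScriptLExact_iff_genusPoint_of_generatesFreePart hGZK hsq h8 hr D h35 hLs hρ hα₁).mp h⟩
  · rintro ⟨α, hα, hm⟩
    exact (levelTwoScriptLExact_iff_genusPoint_of_generatesFreePart hGZK hsq h8 hr D h35 hLs hρ hα).mpr hm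

/-! ## §3 Transfer to the registered stub C⁺ = `stub_offTYZ_levelTwoScriptLExact` -/

/-- Two sign choices of `𝓛(n)` differ by a sign: `IsScriptL n L`, `IsScriptL n L′` ⟹ `L = L′ ∨ L = −L′`.
[cite: TianYuanZhang2017, §1 (p0002 L77: "𝓛(n) is … defined up to a sign")] -/
theorem eq_or_eq_neg_of_isScriptL {L L' : ℤ} (hL : IsScriptL n L) (hL' : IsScriptL n L') : L = L' ∨ L = -L' := by
  have h : ((L : ℂ)) ^ 2 = ((L' : ℂ)) ^ 2 := by rw [hL, hL']
  have h' : L ^ 2 = L' ^ 2 := by exact_mod_cast h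
  exact sq_eq_sq_iff_eq_or_eq_neg.mp h'

/-- `2 ∣ L ∧ 4 ∤ L` is invariant under the sign of `L`. [folklore] -/
theorem two_dvd_not_four_dvd_of_eq_or_eq_neg {L L' : ℤ} (h : L = L' ∨ L = -L')
    (hL' : (2 : ℤ) ∣ L' ∧ ¬ (4 : ℤ) ∣ L') : (2 : ℤ) ∣ L ∧ ¬ (4 : ℤ) ∣ L := by
  rcases h with rfl | rfl
  · exact hL'
  · exact ⟨(dvd_neg).mpr hL'.1, fun h4 => hL'.2 ((dvd_neg).mp h4)⟩

/-- **C⁺ ⟹ the point statement.** If C⁺ (`stub_offTYZ_levelTwoScriptLExact`, hypothesis `hC`, verbatim) holds, then —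
granted GZK — on every member `n` of the jump-one rank-one class, for every data `D : GenusPointData n` satisfying the
displayed main clause of Thm 3.5 and the displayed integrality, every `ρ` with `2^ρ = [E_n(ℚ) : φ_n(A_n(ℚ)) + E_n[2]]`
and every generator `α` of the free part of `A(K_n)⁻`: `2^ρ·P(n)` is an ODD multiple of `α` modulo `A(ℍ′_n)_tor`.
[cite: TianYuanZhang2017, Thm. 3.5 (chunk p0011 L94–L100)] [cite: Darmon2004, Thm. 3.22] -/
theorem genusPoint_of_levelTwoScriptLExact (hGZK : rank_eq_analyticRank_of_analyticRank_le_one)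
    (hC : (∀ (n : ℕ) [(congruentNumberCurve n).IsElliptic] [(congruentNumberCurve n).IsGloballyMinimal],
      Squarefree n → (n % 8 = 5 ∨ n % 8 = 6 ∨ n % 8 = 7) →
      (congruentNumberCurve n).analyticRank = 1 →
      Nat.card ((congruentNumberCurve n).selmerGroup 2) = 2 ^ 5 →
      Nat.card ((congruentNumberCurve n).selmerGroup 4) = 2 ^ 6 →
      ∀ L : ℤ, IsScriptL n L → (2 : ℤ) ∣ L ∧ ¬ (4 : ℤ) ∣ L)) :
    (∀ (n : ℕ) [(congruentNumberCurve n).IsElliptic] [(congruentNumberCurve n).IsGloballyMinimal]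
      (hsq : Squarefree n), (n % 8 = 5 ∨ n % 8 = 6 ∨ n % 8 = 7) →
      (congruentNumberCurve n).analyticRank = 1 →
      Nat.card ((congruentNumberCurve n).selmerGroup 2) = 2 ^ 5 →
      Nat.card ((congruentNumberCurve n).selmerGroup 4) = 2 ^ 6 →
      ∀ (D : GenusPointData n), D.thm35Main → D.scriptLSpec →
      ∀ (ρ : ℕ), (rhoSubgroup n).index = 2 ^ ρ →
      ∀ (α : APoint (GenusField n)), GeneratesFreePart n α →
        ∃ m : ℤ, Odd m ∧ IsOfFinAddOrder (((2 : ℤ) ^ ρ) • D.P n -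
          m • Point.map (W' := curveA) (D.embK n (Nat.mem_divisors_self n hsq.ne_zero)) α)) := by
  intro n _ _ hsq h8 hr hS₂ hS₄ D h35 hLs ρ hρ α hα
  have hn1 : 1 < n := by rcases h8 with h | h | h <;> omega
  have hL : IsScriptL n (D.scriptL n) := hLs n (Nat.mem_divisors_self n hsq.ne_zero) hn1
  exact (levelTwoScriptLExact_iff_genusPoint_of_generatesFreePart hGZK hsq h8 hr D h35 hLs hρ hα).mp
    (hC n hsq h8 hr hS₂ hS₄ (D.scriptL n) hL)

/-- **The point statement ⟹ C⁺, VERBATIM.** If on every member `n` of the jump-one rank-one class there are data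
`D : GenusPointData n` with Thm 3.5's displayed main clause and integrality, a `ρ` with `2^ρ = [E_n(ℚ) : φ_n(A_n(ℚ)) +
E_n[2]]`, and a generator `α` of the free part of `A(K_n)⁻` with `2^ρ·P(n) − m·α` torsion for an ODD `m`, then — granted
GZK — C⁺ holds (for EVERY sign choice `L` of `𝓛(n)`: `L = ±D.scriptL n`). This is the exact shape in which a level-two
genus-point theorem would discharge the registered stub. [cite: TianYuanZhang2017, Thm. 3.5 (chunk p0011 L94–L100)] [cite: Darmon2004, Thm. 3.22] -/
theorem levelTwoScriptLExact_of_genusPoint (hGZK : rank_eq_analyticRank_of_analyticRank_le_one)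
    (hP : (∀ (n : ℕ) [(congruentNumberCurve n).IsElliptic] [(congruentNumberCurve n).IsGloballyMinimal]
      (hsq : Squarefree n), (n % 8 = 5 ∨ n % 8 = 6 ∨ n % 8 = 7) →
      (congruentNumberCurve n).analyticRank = 1 →
      Nat.card ((congruentNumberCurve n).selmerGroup 2) = 2 ^ 5 →
      Nat.card ((congruentNumberCurve n).selmerGroup 4) = 2 ^ 6 →
      ∃ (D : GenusPointData n), D.thm35Main ∧ D.scriptLSpec ∧
      ∃ (ρ : ℕ), (rhoSubgroup n).index = 2 ^ ρ ∧
      ∃ (α : APoint (GenusField n)), GeneratesFreePart n α ∧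
        ∃ m : ℤ, Odd m ∧ IsOfFinAddOrder (((2 : ℤ) ^ ρ) • D.P n -
          m • Point.map (W' := curveA) (D.embK n (Nat.mem_divisors_self n hsq.ne_zero)) α))) :
    (∀ (n : ℕ) [(congruentNumberCurve n).IsElliptic] [(congruentNumberCurve n).IsGloballyMinimal],
      Squarefree n → (n % 8 = 5 ∨ n % 8 = 6 ∨ n % 8 = 7) →
      (congruentNumberCurve n).analyticRank = 1 →
      Nat.card ((congruentNumberCurve n).selmerGroup 2) = 2 ^ 5 →
      Nat.card ((congruentNumberCurve n).selmerGroup 4) = 2 ^ 6 →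
      ∀ L : ℤ, IsScriptL n L → (2 : ℤ) ∣ L ∧ ¬ (4 : ℤ) ∣ L) := by
  intro n _ _ hsq h8 hr hS₂ hS₄ L hL
  obtain ⟨D, h35, hLs, ρ, hρ, α, hα, hm⟩ := hP n hsq h8 hr hS₂ hS₄
  have hn1 : 1 < n := by rcases h8 with h | h | h <;> omega
  have hLD : IsScriptL n (D.scriptL n) := hLs n (Nat.mem_divisors_self n hsq.ne_zero) hn1
  exact two_dvd_not_four_dvd_of_eq_or_eq_neg (eq_or_eq_neg_of_isScriptL hL hLD)
    ((levelTwoScriptLExact_iff_genusPoint_of_generatesFreePart hGZK hsq h8 hr D h35 hLs hρ hα).mpr hm)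

/-- **Granted TYZ §3 as printed (`tyz_genusPointData`, ONE named fact, NOT a conjunct of 𝔅_ram) and GZK, C⁺ is
EQUIVALENT to the level-two genus-point statement** «on the jump-one rank-one class, for all displayed data, all `ρ`,
all generators `α`: `2^{ρ(n)}·P(n)` is an odd multiple of `α` modulo `A(ℍ′_n)_tor`». (The `∀`-form on the right; the
existence of data, of `ρ` (`W2.stub_S3`) and of a generator (`exists_generatesFreePart_not_isOfFinAddOrder`) turns it
into the `∃`-form consumed by `levelTwoScriptLExact_of_genusPoint`.)
[cite: TianYuanZhang2017, §3 (Prop. 3.4, Thm. 3.5) (chunk p0011 L76–L112)] [cite: Darmon2004, Thm. 3.22] -/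
theorem levelTwoScriptLExact_iff_genusPoint_of_tyz (hTYZ : tyz_genusPointData)
    (hGZK : rank_eq_analyticRank_of_analyticRank_le_one) :
    (∀ (n : ℕ) [(congruentNumberCurve n).IsElliptic] [(congruentNumberCurve n).IsGloballyMinimal],
      Squarefree n → (n % 8 = 5 ∨ n % 8 = 6 ∨ n % 8 = 7) →
      (congruentNumberCurve n).analyticRank = 1 →
      Nat.card ((congruentNumberCurve n).selmerGroup 2) = 2 ^ 5 →
      Nat.card ((congruentNumberCurve n).selmerGroup 4) = 2 ^ 6 →
      ∀ L : ℤ, IsScriptL n L → (2 : ℤ) ∣ L ∧ ¬ (4 : ℤ) ∣ L) ↔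
    (∀ (n : ℕ) [(congruentNumberCurve n).IsElliptic] [(congruentNumberCurve n).IsGloballyMinimal]
      (hsq : Squarefree n), (n % 8 = 5 ∨ n % 8 = 6 ∨ n % 8 = 7) →
      (congruentNumberCurve n).analyticRank = 1 →
      Nat.card ((congruentNumberCurve n).selmerGroup 2) = 2 ^ 5 →
      Nat.card ((congruentNumberCurve n).selmerGroup 4) = 2 ^ 6 →
      ∀ (D : GenusPointData n), D.thm35Main → D.scriptLSpec →
      ∀ (ρ : ℕ), (rhoSubgroup n).index = 2 ^ ρ →
      ∀ (α : APoint (GenusField n)), GeneratesFreePart n α →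
        ∃ m : ℤ, Odd m ∧ IsOfFinAddOrder (((2 : ℤ) ^ ρ) • D.P n -
          m • Point.map (W' := curveA) (D.embK n (Nat.mem_divisors_self n hsq.ne_zero)) α)) := by
  refine ⟨genusPoint_of_levelTwoScriptLExact hGZK, fun hP => levelTwoScriptLExact_of_genusPoint hGZK ?_⟩
  intro n _ _ hsq h8 hr hS₂ hS₄
  obtain ⟨D, hLs, -, -, -, h35, -⟩ := hTYZ n hsq h8
  obtain ⟨ρ, hρ⟩ := stub_S3 hsq
  obtain ⟨α, hα, -⟩ := exists_generatesFreePart_not_isOfFinAddOrder hGZK hsq hr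
  exact ⟨D, h35, hLs, ρ, hρ, α, hα, hP n hsq h8 hr hS₂ hS₄ D h35 hLs ρ hρ α hα⟩

/-! ## §4 (append, LEAD g0) Necessary conditions: C⁺ forces EVEN genus sums on the class — falsifier handles -/

/-- **C⁺ ⟹ the genus sums are EVEN on the jump-one rank-one class** (granted TYZ §3 as printed and GZK): the tree's
U⁺ (`W2.uPlus_genusField_of`: `2 ∣ 𝓛(n) ⟹ Σ₁, Σ₂′ even` for `n ≡ 5, 7`, `Σ₂′` even for `n ≡ 6`) turns the level-ONE half
of C⁺ into a COMPUTABLE necessary condition on every member of the class (Rédei matrices only) — the disprover's cheapest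
handle. [cite: TianYuanZhang2017, Thm. 1.2 and Thm. 3.5 (2) (chunk p0011 L100–L112)] [cite: Darmon2004, Thm. 3.22] -/
theorem genusSums_even_of_levelTwoScriptLExact (hTYZ : tyz_genusPointData)
    (hGZK : rank_eq_analyticRank_of_analyticRank_le_one)
    (hC : (∀ (n : ℕ) [(congruentNumberCurve n).IsElliptic] [(congruentNumberCurve n).IsGloballyMinimal],
      Squarefree n → (n % 8 = 5 ∨ n % 8 = 6 ∨ n % 8 = 7) →
      (congruentNumberCurve n).analyticRank = 1 →
      Nat.card ((congruentNumberCurve n).selmerGroup 2) = 2 ^ 5 →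
      Nat.card ((congruentNumberCurve n).selmerGroup 4) = 2 ^ 6 →
      ∀ L : ℤ, IsScriptL n L → (2 : ℤ) ∣ L ∧ ¬ (4 : ℤ) ∣ L))
    (hsq : Squarefree n) (h8 : n % 8 = 5 ∨ n % 8 = 6 ∨ n % 8 = 7)
    [(congruentNumberCurve n).IsElliptic] [(congruentNumberCurve n).IsGloballyMinimal]
    (hr : (congruentNumberCurve n).analyticRank = 1)
    (hS₂ : Nat.card ((congruentNumberCurve n).selmerGroup 2) = 2 ^ 5)
    (hS₄ : Nat.card ((congruentNumberCurve n).selmerGroup 4) = 2 ^ 6) :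
    ((n % 8 = 5 ∨ n % 8 = 7) → Even (genusSum₁ n gK) ∧ Even (genusSum₂' n gK)) ∧
      (n % 8 = 6 → Even (genusSum₂' n gK)) := by
  obtain ⟨L, hL, h57, h6⟩ := uPlus_genusField_of hTYZ hGZK n hsq h8
  exact ⟨fun h => h57 h (hC n hsq h8 hr hS₂ hS₄ L hL).1, fun h => h6 h (hC n hsq h8 hr hS₂ hS₄ L hL).1⟩

/-- **An odd genus sum on the jump-one rank-one class would REFUTE `BSD(E_n, 2)`** (granted TYZ §3 and GZK): the door
is exact (`BSD₂ ⟺ 2 ∥ 𝓛(n)`) and U⁺ makes `Σ₁` (`n ≡ 5, 7`) and `Σ₂′` even once `2 ∣ 𝓛(n)`; contrapositively BSD₂ predicts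
the class-group law «s(n) = 3, jump one, r_an = 1 ⟹ Σ₁, Σ₂′ even», the census-checkable shadow of C⁺.
[cite: TianYuanZhang2017, Thm. 1.2 and §1 (1.1)] [cite: Miller2011LMS, Def. 1.1] [cite: Darmon2004, Thm. 3.22] -/
theorem not_bsdp_two_of_odd_genusSum (hTYZ : tyz_genusPointData)
    (hGZK : rank_eq_analyticRank_of_analyticRank_le_one)
    (hsq : Squarefree n) (h8 : n % 8 = 5 ∨ n % 8 = 6 ∨ n % 8 = 7) [(congruentNumberCurve n).IsElliptic]
    (hr : (congruentNumberCurve n).analyticRank = 1)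
    (hS₂ : Nat.card ((congruentNumberCurve n).selmerGroup 2) = 2 ^ 5)
    (hS₄ : Nat.card ((congruentNumberCurve n).selmerGroup 4) = 2 ^ 6)
    (hodd : ((n % 8 = 5 ∨ n % 8 = 7) ∧ Odd (genusSum₁ n gK)) ∨ Odd (genusSum₂' n gK)) :
    ¬ BSDp (congruentNumberCurve n) 2 := by
  obtain ⟨L, hL, h57, h6⟩ := uPlus_genusField_of hTYZ hGZK n hsq h8
  intro hB
  have h2 : (2 : ℤ) ∣ L :=
    ((P2.bsdp_two_congruentNumberCurve_iff_two_dvd_not_four_dvd hGZK hsq hr hL hS₂ hS₄).mp hB).1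
  rcases hodd with ⟨h57', hodd⟩ | hodd
  · exact (Nat.not_even_iff_odd.mpr hodd) (h57 h57' h2).1
  · have hne : ¬ Even (genusSum₂' n gK) := Nat.not_even_iff_odd.mpr hodd
    rcases h8 with h5 | h6' | h7
    exacts [hne (h57 (Or.inl h5) h2).2, hne (h6 h6' h2), hne (h57 (Or.inr h7) h2).2]

end EnSide

end Summit.BirchSwinnertonDyer.PrintCf2.LevelTwo

end
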